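import Summits.CriticalPhenomena.SAWScalingLimit.Theorems.SAWLoopFugacityFlowIsingBoundaryRatioRSWMeshDefs
import Literature.Probability.LatticeModels.FKIsingTopologicalRectangleCrossing
import HarnessLib

/-!
# Definitions for the CDH16 instances of the RSW residual of the line `fk-anchor-transfer`, rev 8
(crux `SAWLoopFugacityFlow.IsingBoundaryRatio`, stmt-CriticalPhenomena-10650)

A small definitions module next to `…IsingBoundaryRatioRSWMeshDefs.lean` (imported, NOT modified). The two
crossing bounds `HalfAnnulusSideCrossingBound` (side-to-side, free) and `HalfAnnulusRimCrossingBound`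
(rim-to-rim, wired) of that module are instances of Chelkak–Duminil-Copin–Hongler 2016, Thm 1.1 (named fact
`Literature.Probability.LatticeModels.fkIsing_topologicalRectangle_crossingBounds`, vocabulary
`DiscreteRect.IsRect`/`arcVerts`, hypothesis on the unit-conductance resistance `ℓ_Ω[(ab),(cd)]`). This
module names the objects through which they are derived:

* `IsWindowRect D φ M ε δ ρ r₁ r₂ r₁' r₂' Λ E d₀ n` — a PRESENTATION of the lattice window of the conformal
  half-annulus as a discrete topological rectangle: `(E, d₀, n)` is an `IsRect` made of `Ω_δ`-edges between
  window sites (`annWindow … r₁ r₂`), its arcs `0` / `2` lie in the left / right rough sides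
  (`annSide … true/false`), it is relatively closed along the inner window `[r₁', r₂']` (every `Ω_δ`-edge from
  a vertex of `E` of inner chart radius to a window site of `Λ` is in `E`), it contains every bulk site of the
  inner window (chart point in the cone `|re| ≤ im`), and conversely every boundary vertex of `E` of inner
  chart radius belongs to arc `0` or arc `2` according to the sign of the real part of its chart point (the two
  rough stretches of the boundary cycle are contiguous), while the rim darts (missing `Ω_δ`-edges towards the
  inside / outside of the window) of chart radius `< r₁'` and `> r₂'` lie on the arcs `1` and `3` (or `3` and
  `1`). These are exactly the properties used (a) to bound the resistance between the arcs `0`, `2` by a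
  foliation of the window by chart semicircles (Chelkak 2016, Prop. 6.2 (i)), (b) to see an open side-to-side
  crossing of `E` as an `AnnSideCross` of the window, and (c) to see an open radial crossing of the annulus as
  an open crossing of `E` between the arcs `1` and `3`.
* `WindowRectPresentation` — TARGET (lattice topology): for small `δ` every finite volume agreeing locally with
  `Ω_δ` and containing the chart disc of radius `Mρ` admits such a presentation.
* `HalfAnnulusRimCrossingBoundLarge`, `RoughHalfAnnulusRSWMeshLargeOf Sep`, `RoughHalfAnnulusRSWLargeOf Sep` —
  the LARGE-MODULUS forms (`∃ M₀, ∀ M ≥ M₀` in place of `∀ M > 1`) of `HalfAnnulusRimCrossingBound`,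
  `RoughHalfAnnulusRSWMeshOf`, `RoughHalfAnnulusRSWOf`: the rim-to-rim bound is obtained from CDH16 Thm 1.1 (ii),
  whose hypothesis `ℓ_Ω[(rims)] ≥ L⁻¹` on the INNER resistance is reached from the self-duality of the external
  extremal lengths and the sandwich `ℓ̄ ≤ ℓ + 4(2√2−1)` (CDH16 §3.3) only when `ℓ̄[(rims)]` is large, i.e.
  for conformal annuli of large modulus; the heart of the line consumes the RSW input at one fixed large
  modulus, so nothing is lost. The large form of the rim bound also carries the hypothesis that the volume
  contains the chart disc (the radial crossing is impossible otherwise, `AnnCross → AnnLink`).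

Every proposition named here is a TARGET of the line, not a cited fact; nothing is asserted.
Sources for the shape of the statements: D. Chelkak, H. Duminil-Copin, C. Hongler, EJP 21 (2016), no. 5,
Thm 1.1, Rem. 2.2, §3.3; D. Chelkak, Ann. Probab. 44 (2016), Prop. 6.2, Cor. 6.3.
-/

noncomputable section

open scoped Classical Topology
open Filter Set Metric SimpleGraph
open Literature.Probability.LatticeModels Literature.Probability.RandomPlanarGeometry
open Literature.Probability.Percolation (BondConfig)
open UpperHalfPlane (upperHalfPlaneSet)

namespace Summit.CriticalPhenomena.SAWScalingLimit.Theorems.IsingBoundaryRatio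

/-- **Presentation of the lattice window as a discrete topological rectangle** (see the module docstring):
`(E, d₀, n)` is a `DiscreteRect.IsRect` of `Ω_δ`-edges between sites of the window `annWindow … r₁ r₂` of
the finite volume `Λ`, with arcs `0 ⊆` left rough side, `2 ⊆` right rough side, relatively closed and
bulk-complete along the inner window `[r₁', r₂']`, whose boundary vertices of inner chart radius are all
on arc `0` (negative real part of the chart point) or arc `2` (positive real part), and whose rim darts of
chart radius `< r₁'` / `> r₂'` lie on the arcs `1` / `3` (or `3` / `1`). [folklore] -/
structure IsWindowRect (D : DobrushinDomain) (φ : ConformalEquiv upperHalfPlaneSet D.carrier)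
    (M ε δ ρ r₁ r₂ r₁' r₂' : ℝ) (Λ : Finset (Site 2)) (E : Finset (Sym2 (Site 2)))
    (d₀ : Site 2 × Fin 4) (n : Fin 4 → ℕ) : Prop where
  /-- one boundary cycle through all external darts, cut into four nonempty arcs -/
  isRect : DiscreteRect.IsRect E d₀ n
  /-- the edges are edges of the mesh graph `Ω_δ` -/
  mem_edgeSet : ∀ e ∈ E, e ∈ (discreteDomainGraph D.carrier δ).edgeSet
  /-- … between window sites of the finite volume -/
  mem_window : ∀ e ∈ E, ∀ x ∈ e, ∃ hx : x ∈ Λ, (⟨x, hx⟩ : ↥Λ) ∈ annWindow D φ M ε δ ρ r₁ r₂ Λ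
  /-- arc `0` lies in the left rough side -/
  arc0_sub : ∀ x ∈ DiscreteRect.arcVerts E d₀ n 0, ∃ hx : x ∈ Λ,
    (⟨x, hx⟩ : ↥Λ) ∈ annSide D φ M ε δ ρ r₁ r₂ Λ true
  /-- arc `2` lies in the right rough side -/
  arc2_sub : ∀ x ∈ DiscreteRect.arcVerts E d₀ n 2, ∃ hx : x ∈ Λ,
    (⟨x, hx⟩ : ↥Λ) ∈ annSide D φ M ε δ ρ r₁ r₂ Λ false
  /-- relative closedness along the inner window: an `Ω_δ`-edge from a vertex of `E` of chart radius in
  `[r₁', r₂']` to a window site of `Λ` belongs to `E` -/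
  closed : ∀ (x y : Site 2) (hy : y ∈ Λ), x ∈ DiscreteRect.verts E →
    r₁' ≤ ‖φ.symm (meshPoint δ x)‖ → ‖φ.symm (meshPoint δ x)‖ ≤ r₂' →
    (discreteDomainGraph D.carrier δ).Adj x y → (⟨y, hy⟩ : ↥Λ) ∈ annWindow D φ M ε δ ρ r₁ r₂ Λ →
    s(x, y) ∈ E
  /-- bulk-completeness along the inner window: every site of `Ω_δ` in the inner window whose chart point
  lies in the cone `|re w| ≤ im w` is a vertex of `E` -/
  bulk_mem : ∀ (x : Site 2) (hx : x ∈ Λ), x ∈ meshDomain D.carrier δ →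
    (⟨x, hx⟩ : ↥Λ) ∈ annWindow D φ M ε δ ρ r₁' r₂' Λ →
    |(φ.symm (meshPoint δ x)).re| ≤ (φ.symm (meshPoint δ x)).im → x ∈ DiscreteRect.verts E
  /-- every boundary vertex of `E` of inner chart radius with chart point of negative real part is on arc `0` -/
  arc0_sup : ∀ x ∈ DiscreteRect.bdVerts E, r₁' ≤ ‖φ.symm (meshPoint δ x)‖ →
    ‖φ.symm (meshPoint δ x)‖ ≤ r₂' → (φ.symm (meshPoint δ x)).re < 0 → x ∈ DiscreteRect.arcVerts E d₀ n 0
  /-- … of positive real part, on arc `2` -/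
  arc2_sup : ∀ x ∈ DiscreteRect.bdVerts E, r₁' ≤ ‖φ.symm (meshPoint δ x)‖ →
    ‖φ.symm (meshPoint δ x)‖ ≤ r₂' → 0 < (φ.symm (meshPoint δ x)).re → x ∈ DiscreteRect.arcVerts E d₀ n 2
  /-- the RIM darts — external darts `(x, k)` of `E` whose missing lattice edge IS an `Ω_δ`-edge to a site of
  `Λ` (so `x` is not of inner chart radius, by `closed`) — of inner chart radius `< r₁'` all lie on one of the
  arcs `1`, `3` and those of outer chart radius `> r₂'` on the other (positions along the boundary cycle) -/
  rim_darts :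
    (∀ i < n 0 + n 1 + n 2 + n 3,
      (discreteDomainGraph D.carrier δ).Adj ((DiscreteRect.succ E)^[i] d₀).1
          (((DiscreteRect.succ E)^[i] d₀).1 + DiscreteRect.dir ((DiscreteRect.succ E)^[i] d₀).2) →
      ((DiscreteRect.succ E)^[i] d₀).1 + DiscreteRect.dir ((DiscreteRect.succ E)^[i] d₀).2 ∈ Λ →
      (‖φ.symm (meshPoint δ ((DiscreteRect.succ E)^[i] d₀).1)‖ < r₁' →
          DiscreteRect.lo n 1 ≤ i ∧ i < DiscreteRect.lo n 1 + n 1) ∧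
        (r₂' < ‖φ.symm (meshPoint δ ((DiscreteRect.succ E)^[i] d₀).1)‖ →
          DiscreteRect.lo n 3 ≤ i ∧ i < DiscreteRect.lo n 3 + n 3)) ∨
    (∀ i < n 0 + n 1 + n 2 + n 3,
      (discreteDomainGraph D.carrier δ).Adj ((DiscreteRect.succ E)^[i] d₀).1
          (((DiscreteRect.succ E)^[i] d₀).1 + DiscreteRect.dir ((DiscreteRect.succ E)^[i] d₀).2) →
      ((DiscreteRect.succ E)^[i] d₀).1 + DiscreteRect.dir ((DiscreteRect.succ E)^[i] d₀).2 ∈ Λ →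
      (‖φ.symm (meshPoint δ ((DiscreteRect.succ E)^[i] d₀).1)‖ < r₁' →
          DiscreteRect.lo n 3 ≤ i ∧ i < DiscreteRect.lo n 3 + n 3) ∧
        (r₂' < ‖φ.symm (meshPoint δ ((DiscreteRect.succ E)^[i] d₀).1)‖ →
          DiscreteRect.lo n 1 ≤ i ∧ i < DiscreteRect.lo n 1 + n 1))

/-- **The lattice window admits a rectangle presentation** (TARGET; lattice topology of `Ω_δ ⊆ δℤ²` in the
chordal chart, no probability). For the chordal chart `φ` of `(D; a, b)`, `M > 1`, `ε > 0` there is `ρ₀ > 0`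
such that for every scale `ρ < ρ₀`, all radii `ρ < r₁ < r₁' < r₂' < r₂ < Mρ` and all small `δ`, every finite
volume `Λ` agreeing locally with `Ω_δ` in `B(a, ε)` and containing every vertex of `Ω_δ` of chart radius
`< Mρ` admits `E, d₀, n` with `IsWindowRect D φ M ε δ ρ r₁ r₂ r₁' r₂' Λ E d₀ n` (route: the `Ω_δ`-edges of
the window component of the bulk, filled and closed along the inner window; its boundary is one dart cycle —
the union of its closed faces is hole-free, cf. `InnerFacesHoleFree`, `DiscreteFaceBoundary` — and the chart
radius is monotone up to the lattice oscillation along each rough stretch, so that cutting the cycle at four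
darts of chart radius `≈ (r₁+r₁')/2`, `≈ (r₂'+r₂)/2` on either side gives the four arcs). -/
def WindowRectPresentation : Prop :=
  ∀ (D : DobrushinDomain) (φ : ConformalEquiv upperHalfPlaneSet D.carrier),
    D.IsChordalUniformizing φ → ∀ (M : ℝ), 1 < M → ∀ (ε : ℝ), 0 < ε →
      ∃ ρ₀ : ℝ, 0 < ρ₀ ∧ ∀ (ρ : ℝ), 0 < ρ → ρ < ρ₀ → ∀ (r₁ r₁' r₂' r₂ : ℝ),
        ρ < r₁ → r₁ < r₁' → r₁' < r₂' → r₂' < r₂ → r₂ < M * ρ →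
        ∀ᶠ δ in 𝓝[>] (0 : ℝ), ∀ (Λ : Finset (Site 2)),
          LocalAgreement D.carrier (D.pt 0) ε δ (discreteDomainGraph D.carrier δ) Λ →
          (∀ x ∈ meshDomain D.carrier δ, ‖φ.symm (meshPoint δ x)‖ < M * ρ → x ∈ Λ) →
            ∃ (E : Finset (Sym2 (Site 2))) (d₀ : Site 2 × Fin 4) (n : Fin 4 → ℕ),
              IsWindowRect D φ M ε δ ρ r₁ r₂ r₁' r₂' Λ E d₀ n

/-- **Upper bound for the rim-to-rim crossing, LARGE-MODULUS form** (TARGET; CDH16 Thm 1.1 (ii) with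
Remark 2.2 for the window rectangle with the rims as marked arcs, its inner rim-to-rim resistance being
large once the modulus is: self-duality of the external extremal lengths and the sandwich of CDH16 §3.3).
For the chordal chart `φ` there is `M₀ > 1` such that for every `M ≥ M₀` there is `c > 0` with: for every `ε`
there is `ρ₀ > 0` such that for every `ρ < ρ₀`, all small `δ` and every finite volume `Λ` agreeing locally
with `Ω_δ` in `B(a, ε)` AND containing every vertex of `Ω_δ` of chart radius `< Mρ`, the critical FK-Ising
measure of the local graph `⟨U⟩` with all vertices off the annulus wired gives the open radial crossing
`AnnCross` probability `≤ 1 - c`. (The volume hypothesis costs nothing downstream: a radial crossing is a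
link, `AnnCross → AnnLink`, and a linked volume contains the chart disc, `forall_mem_of_annLink`.) -/
def HalfAnnulusRimCrossingBoundLarge : Prop :=
  ∀ (D : DobrushinDomain) (φ : ConformalEquiv upperHalfPlaneSet D.carrier),
    D.IsChordalUniformizing φ → ∃ M₀ : ℝ, 1 < M₀ ∧ ∀ (M : ℝ), M₀ ≤ M → ∃ c : ℝ, 0 < c ∧ ∀ (ε : ℝ), 0 < ε →
      ∃ ρ₀ : ℝ, 0 < ρ₀ ∧ ∀ (ρ : ℝ), 0 < ρ → ρ < ρ₀ → ∀ᶠ δ in 𝓝[>] (0 : ℝ),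
        ∀ (Λ : Finset (Site 2)),
          LocalAgreement D.carrier (D.pt 0) ε δ (discreteDomainGraph D.carrier δ) Λ →
          (∀ x ∈ meshDomain D.carrier δ, ‖φ.symm (meshPoint δ x)‖ < M * ρ → x ∈ Λ) →
            let H : SimpleGraph Λ := (discreteDomainGraph D.carrier δ).comap Subtype.val
            let In : Set Λ := annIn D φ ε δ ρ Λ
            let Ann : Set Λ := annBody D φ M ε δ ρ Λ
            (rcMeasure (fromEdgeSet (↑(annEdgeFinset H Ann) : Set (Sym2 Λ)))
                (1 - Real.exp (-2 * criticalBetaTwo)) 2 Annᶜ).real {ω | AnnCross H In Ann ω} ≤ 1 - c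

/-- **Rough half-annulus RSW for the mesh graph with extremal boundary conditions, LARGE-MODULUS form**:
literally `RoughHalfAnnulusRSWMeshOf Sep` with `∃ M₀ > 1, ∀ M ≥ M₀` in place of `∀ M > 1`. [folklore] -/
def RoughHalfAnnulusRSWMeshLargeOf
    (Sep : ∀ {Λ : Finset (Site 2)}, SimpleGraph Λ → Set Λ → Set Λ → BondConfig Λ → Prop) : Prop :=
  ∀ (D : DobrushinDomain) (φ : ConformalEquiv upperHalfPlaneSet D.carrier),
    D.IsChordalUniformizing φ → ∃ M₀ : ℝ, 1 < M₀ ∧ ∀ (M : ℝ), M₀ ≤ M → ∃ c : ℝ, 0 < c ∧ ∀ (ε : ℝ), 0 < ε →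
      ∃ ρ₀ : ℝ, 0 < ρ₀ ∧ ∀ (ρ : ℝ), 0 < ρ → ρ < ρ₀ → ∀ᶠ δ in 𝓝[>] (0 : ℝ),
        ∀ (Λ : Finset (Site 2)),
          LocalAgreement D.carrier (D.pt 0) ε δ (discreteDomainGraph D.carrier δ) Λ →
            let H : SimpleGraph Λ := (discreteDomainGraph D.carrier δ).comap Subtype.val
            let In : Set Λ := annIn D φ ε δ ρ Λ
            let Ann : Set Λ := annBody D φ M ε δ ρ Λ
            c ≤ (rcMeasure (fromEdgeSet (↑(annEdgeFinset H Ann) : Set (Sym2 Λ)))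
                (1 - Real.exp (-2 * criticalBetaTwo)) 2 ∅).real {ω | Sep H In Ann ω} ∧
            (rcMeasure (fromEdgeSet (↑(annEdgeFinset H Ann) : Set (Sym2 Λ)))
                (1 - Real.exp (-2 * criticalBetaTwo)) 2 Annᶜ).real {ω | AnnCross H In Ann ω} ≤ 1 - c

/-- **Rough half-annulus RSW, conditional-cylinder form, LARGE-MODULUS form**: literally
`RoughHalfAnnulusRSWOf Sep` with `∃ M₀ > 1, ∀ M ≥ M₀` in place of `∀ M > 1` — the RSW input of the heart of
the line (`stub_fkArmOriginForgettingPath`, rev 8), which uses it at one fixed large modulus. [folklore] -/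
def RoughHalfAnnulusRSWLargeOf
    (Sep : ∀ {Λ : Finset (Site 2)}, SimpleGraph Λ → Set Λ → Set Λ → BondConfig Λ → Prop) : Prop :=
  ∀ (D : DobrushinDomain) (φ : ConformalEquiv upperHalfPlaneSet D.carrier),
    D.IsChordalUniformizing φ → ∃ M₀ : ℝ, 1 < M₀ ∧ ∀ (M : ℝ), M₀ ≤ M → ∃ c : ℝ, 0 < c ∧ ∀ (ε : ℝ), 0 < ε →
      ∃ ρ₀ : ℝ, 0 < ρ₀ ∧ ∀ (ρ : ℝ), 0 < ρ → ρ < ρ₀ → ∀ᶠ δ in 𝓝[>] (0 : ℝ),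
        ∀ (G : SimpleGraph (Site 2)) [G.LocallyFinite] (Λ : Finset (Site 2)),
          LocalAgreement D.carrier (D.pt 0) ε δ G Λ →
          ∀ (ξ : Set (Sym2 Λ)),
            let H : SimpleGraph Λ := G.comap Subtype.val
            let In : Set Λ := annIn D φ ε δ ρ Λ
            let Ann : Set Λ := annBody D φ M ε δ ρ Λ
            let U : Set (Sym2 Λ) := {e | e ∈ H.edgeSet ∧ ∃ v ∈ Ann, v ∈ e}
            let P := rcMeasure H (1 - Real.exp (-2 * criticalBetaTwo)) 2 ∅
            c * P.real {ω | ω ∩ Uᶜ = ξ} ≤ P.real ({ω | Sep H In Ann ω} ∩ {ω | ω ∩ Uᶜ = ξ}) ∧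
            P.real ({ω | AnnCross H In Ann ω} ∩ {ω | ω ∩ Uᶜ = ξ}) ≤
              (1 - c) * P.real {ω | ω ∩ Uᶜ = ξ}

/-- The all-moduli form implies the large-modulus form (with `M₀ = 2`); registered sub-goal of
stmt-CriticalPhenomena-10650. [folklore] -/
theorem roughHalfAnnulusRSWMeshLargeOf_of_meshOf : ∀ (Sep : ∀ {Λ : Finset (Site 2)}, SimpleGraph Λ → Set Λ → Set Λ → BondConfig Λ → Prop), RoughHalfAnnulusRSWMeshOf Sep → RoughHalfAnnulusRSWMeshLargeOf Sep :=
  fun _ h D φ hφ => ⟨2, one_lt_two, fun M hM => h D φ hφ M (one_lt_two.trans_le hM)⟩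

/-- The all-moduli form implies the large-modulus form (with `M₀ = 2`), conditional-cylinder version;
registered sub-goal of stmt-CriticalPhenomena-10650. [folklore] -/
theorem roughHalfAnnulusRSWLargeOf_of_of : ∀ (Sep : ∀ {Λ : Finset (Site 2)}, SimpleGraph Λ → Set Λ → Set Λ → BondConfig Λ → Prop), RoughHalfAnnulusRSWOf Sep → RoughHalfAnnulusRSWLargeOf Sep :=
  fun _ h D φ hφ => ⟨2, one_lt_two, fun M hM => h D φ hφ M (one_lt_two.trans_le hM)⟩

end Summit.CriticalPhenomena.SAWScalingLimit.Theorems.IsingBoundaryRatio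

end
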